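import Mathlib
import Summits.Ventures.PercRepro.TriangleCapRowA1Arith5

/-!
# PercRepro — TOWARDS THE ROW `r = a + 2`: THE ARITHMETIC OF THE DELETION READS (p3, gen 47; part 200zq)

A vertex `z` of degree `d ≤ a − 1` deleted onto `(k − 1, a, d + 2)`, `D − z` not `a`-bipartite with the gap of its cell
(`B2` regime for `d + 5 ≤ a`, the `T` cell at `d = a − 4`, the `B2` cell `r = a − 1` at `d = a − 3`, the cell `r = a`
at `d = a − 2`, the cell `r = a + 1` at `d = a − 1`), the neighbours of `z` at `≤ k − a − 2` in `D − z`, against the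
triple-broom target `(a + 2)(k − 1 − (a + 2)) + (2k + 2a − 14)` (`a = q + 5`, `k = 3a + 2 + c`): slacks
`2e(…) − … ≥ 16` (`B2`), `2 + 2q` (`T`), `2` (`r = a − 1`), `0` (`r = a`), `0` (`r = a + 1`); and the mixed read for
`2 ≤ d ≤ a − 3` (`D − z` `a`-bipartite, one off-side neighbour at `≤ a`): slack `2 (e − 2)(q + 3 − e)` where
`d = a − 1 − e`. Axioms: standard.
-/

namespace PercRepro

namespace TriangleCap

namespace C047

/-- `d + 5 ≤ a`: `D − z` on a `B2` cell `(k − 1, a, d + 2)`. -/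
theorem rowA2_del_B2 (a d k m' S' T : ℕ) (ha : 5 ≤ a) (hda : d + 5 ≤ a) (hk : 3 * a + 2 ≤ k)
    (hmd : m' + d + (a + 2) = a * (k - a))
    (hgap : S' + (d + 2) * (k - 1 - 1 - (d + 2)) + 2 * (k - 1 - 2 * a - 1) * (a - (d + 2)) ≤ m' * (k - 1))
    (hT : T ≤ d * (k - a - 2)) :
    S' + 2 * T + d + d * d + (a + 2) * (k - 1 - (a + 2)) + (2 * k + 2 * a - 14) ≤ (m' + d) * k := by
  obtain ⟨q, rfl⟩ : ∃ q, a = q + 5 := ⟨a - 5, by omega⟩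
  obtain ⟨e, he⟩ : ∃ e, d + e = q + 4 := ⟨q + 4 - d, by omega⟩
  have he4 : 4 ≤ e := by omega
  obtain ⟨c, rfl⟩ : ∃ c, k = 3 * (q + 5) + 2 + c := ⟨k - (3 * (q + 5) + 2), by omega⟩
  have e1 : 3 * (q + 5) + 2 + c - 1 - 1 - (d + 2) = 2 * q + 9 + c + e := by omega
  have e2 : 3 * (q + 5) + 2 + c - 1 - 2 * (q + 5) - 1 = q + 5 + c := by omega
  have e3 : q + 5 - (d + 2) = e - 1 := by omega
  have e4 : 3 * (q + 5) + 2 + c - 1 = 3 * q + 16 + c := by omega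
  have e5 : 3 * (q + 5) + 2 + c - (q + 5) - 2 = 2 * q + 10 + c := by omega
  have e6 : 3 * (q + 5) + 2 + c - 1 - (q + 5 + 2) = 2 * q + 9 + c := by omega
  have e7 : 2 * (3 * (q + 5) + 2 + c) + 2 * (q + 5) - 14 = 8 * q + 30 + 2 * c := by omega
  have e8 : 3 * (q + 5) + 2 + c - (q + 5) = 2 * q + 12 + c := by omega
  rw [e1, e2, e3, e4] at hgap
  rw [e5] at hT
  rw [e6, e7]
  rw [e8] at hmd
  obtain ⟨f, rfl⟩ : ∃ f, e = f + 4 := ⟨e - 4, by omega⟩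
  have hf : f ≤ q := by omega
  have hff : f * f ≤ f * q := Nat.mul_le_mul_left f hf
  have e9 : f + 4 - 1 = f + 3 := by omega
  rw [e9] at hgap
  nlinarith [hgap, hT, hmd, hff, he]

/-- `d = a − 4`: `D − z` on the `T` cell `(k − 1, a, a − 2)`. -/
theorem rowA2_del_T (a k m' S' T : ℕ) (ha : 5 ≤ a) (hk : 3 * a + 2 ≤ k)
    (hmd : m' + (a - 4) + (a + 2) = a * (k - a))
    (hgap : S' + (a - 2) * (k - 1 - 1 - (a - 2)) + 2 * (k - 1 - 2 * a - 1) ≤ m' * (k - 1))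
    (hT : T ≤ (a - 4) * (k - a - 2)) :
    S' + 2 * T + (a - 4) + (a - 4) * (a - 4) + (a + 2) * (k - 1 - (a + 2)) + (2 * k + 2 * a - 14) ≤
      (m' + (a - 4)) * k := by
  obtain ⟨q, rfl⟩ : ∃ q, a = q + 5 := ⟨a - 5, by omega⟩
  obtain ⟨c, rfl⟩ : ∃ c, k = 3 * (q + 5) + 2 + c := ⟨k - (3 * (q + 5) + 2), by omega⟩
  have e0 : q + 5 - 4 = q + 1 := by omega
  have e0' : q + 5 - 2 = q + 3 := by omega
  have e1 : 3 * (q + 5) + 2 + c - 1 - 1 - (q + 3) = 2 * q + 12 + c := by omega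
  have e2 : 3 * (q + 5) + 2 + c - 1 - 2 * (q + 5) - 1 = q + 5 + c := by omega
  have e4 : 3 * (q + 5) + 2 + c - 1 = 3 * q + 16 + c := by omega
  have e5 : 3 * (q + 5) + 2 + c - (q + 5) - 2 = 2 * q + 10 + c := by omega
  have e6 : 3 * (q + 5) + 2 + c - 1 - (q + 5 + 2) = 2 * q + 9 + c := by omega
  have e7 : 2 * (3 * (q + 5) + 2 + c) + 2 * (q + 5) - 14 = 8 * q + 30 + 2 * c := by omega
  have e8 : 3 * (q + 5) + 2 + c - (q + 5) = 2 * q + 12 + c := by omega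
  rw [e0] at hmd hT ⊢
  rw [e0', e1, e2, e4] at hgap
  rw [e5] at hT
  rw [e6, e7]
  rw [e8] at hmd
  nlinarith [hgap, hT, hmd]

/-- `d = a − 3`: `D − z` on the `B2` cell `(k − 1, a, a − 1)`. -/
theorem rowA2_del_B (a k m' S' T : ℕ) (ha : 5 ≤ a) (hk : 3 * a + 2 ≤ k)
    (hmd : m' + (a - 3) + (a + 2) = a * (k - a))
    (hgap : S' + (a - 1) * (k - 1 - 1 - (a - 1)) + 2 * (k - 1 - 2 * a - 1) ≤ m' * (k - 1))
    (hT : T ≤ (a - 3) * (k - a - 2)) :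
    S' + 2 * T + (a - 3) + (a - 3) * (a - 3) + (a + 2) * (k - 1 - (a + 2)) + (2 * k + 2 * a - 14) ≤
      (m' + (a - 3)) * k := by
  obtain ⟨q, rfl⟩ : ∃ q, a = q + 5 := ⟨a - 5, by omega⟩
  obtain ⟨c, rfl⟩ : ∃ c, k = 3 * (q + 5) + 2 + c := ⟨k - (3 * (q + 5) + 2), by omega⟩
  have e0 : q + 5 - 3 = q + 2 := by omega
  have e0' : q + 5 - 1 = q + 4 := by omega
  have e1 : 3 * (q + 5) + 2 + c - 1 - 1 - (q + 4) = 2 * q + 11 + c := by omega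
  have e2 : 3 * (q + 5) + 2 + c - 1 - 2 * (q + 5) - 1 = q + 5 + c := by omega
  have e4 : 3 * (q + 5) + 2 + c - 1 = 3 * q + 16 + c := by omega
  have e5 : 3 * (q + 5) + 2 + c - (q + 5) - 2 = 2 * q + 10 + c := by omega
  have e6 : 3 * (q + 5) + 2 + c - 1 - (q + 5 + 2) = 2 * q + 9 + c := by omega
  have e7 : 2 * (3 * (q + 5) + 2 + c) + 2 * (q + 5) - 14 = 8 * q + 30 + 2 * c := by omega
  have e8 : 3 * (q + 5) + 2 + c - (q + 5) = 2 * q + 12 + c := by omega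
  rw [e0] at hmd hT ⊢
  rw [e0', e1, e2, e4] at hgap
  rw [e5] at hT
  rw [e6, e7]
  rw [e8] at hmd
  nlinarith [hgap, hT, hmd]

/-- `d = a − 2`: `D − z` on the cell `(k − 1, a, a)` at its gap `2 (k − 1 − a − 3)`: exact. -/
theorem rowA2_del_A (a k m' S' T : ℕ) (ha : 5 ≤ a) (hk : 3 * a + 2 ≤ k)
    (hmd : m' + (a - 2) + (a + 2) = a * (k - a))
    (hgap : S' + a * (k - 1 - 1 - a) + 2 * (k - 1 - a - 3) ≤ m' * (k - 1))
    (hT : T ≤ (a - 2) * (k - a - 2)) :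
    S' + 2 * T + (a - 2) + (a - 2) * (a - 2) + (a + 2) * (k - 1 - (a + 2)) + (2 * k + 2 * a - 14) ≤
      (m' + (a - 2)) * k := by
  obtain ⟨q, rfl⟩ : ∃ q, a = q + 5 := ⟨a - 5, by omega⟩
  obtain ⟨c, rfl⟩ : ∃ c, k = 3 * (q + 5) + 2 + c := ⟨k - (3 * (q + 5) + 2), by omega⟩
  have e0 : q + 5 - 2 = q + 3 := by omega
  have e1 : 3 * (q + 5) + 2 + c - 1 - 1 - (q + 5) = 2 * q + 10 + c := by omega
  have e2 : 3 * (q + 5) + 2 + c - 1 - (q + 5) - 3 = 2 * q + 8 + c := by omega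
  have e4 : 3 * (q + 5) + 2 + c - 1 = 3 * q + 16 + c := by omega
  have e5 : 3 * (q + 5) + 2 + c - (q + 5) - 2 = 2 * q + 10 + c := by omega
  have e6 : 3 * (q + 5) + 2 + c - 1 - (q + 5 + 2) = 2 * q + 9 + c := by omega
  have e7 : 2 * (3 * (q + 5) + 2 + c) + 2 * (q + 5) - 14 = 8 * q + 30 + 2 * c := by omega
  have e8 : 3 * (q + 5) + 2 + c - (q + 5) = 2 * q + 12 + c := by omega
  rw [e0] at hmd hT ⊢
  rw [e1, e2, e4] at hgap
  rw [e5] at hT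
  rw [e6, e7]
  rw [e8] at hmd
  nlinarith [hgap, hT, hmd]

/-- `d = a − 1`: `D − z` on the cell `(k − 1, a, a + 1)` at its gap `2 (k − 1) − 10`: exact. -/
theorem rowA2_del_A1 (a k m' S' T : ℕ) (ha : 5 ≤ a) (hk : 3 * a + 2 ≤ k)
    (hmd : m' + (a - 1) + (a + 2) = a * (k - a))
    (hgap : S' + (a + 1) * (k - 1 - 1 - (a + 1)) + (2 * (k - 1) - 10) ≤ m' * (k - 1))
    (hT : T ≤ (a - 1) * (k - a - 2)) :
    S' + 2 * T + (a - 1) + (a - 1) * (a - 1) + (a + 2) * (k - 1 - (a + 2)) + (2 * k + 2 * a - 14) ≤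
      (m' + (a - 1)) * k := by
  obtain ⟨q, rfl⟩ : ∃ q, a = q + 5 := ⟨a - 5, by omega⟩
  obtain ⟨c, rfl⟩ : ∃ c, k = 3 * (q + 5) + 2 + c := ⟨k - (3 * (q + 5) + 2), by omega⟩
  have e0 : q + 5 - 1 = q + 4 := by omega
  have e1 : 3 * (q + 5) + 2 + c - 1 - 1 - (q + 5 + 1) = 2 * q + 9 + c := by omega
  have e2 : 2 * (3 * (q + 5) + 2 + c - 1) - 10 = 6 * q + 22 + 2 * c := by omega
  have e4 : 3 * (q + 5) + 2 + c - 1 = 3 * q + 16 + c := by omega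
  have e5 : 3 * (q + 5) + 2 + c - (q + 5) - 2 = 2 * q + 10 + c := by omega
  have e6 : 3 * (q + 5) + 2 + c - 1 - (q + 5 + 2) = 2 * q + 9 + c := by omega
  have e7 : 2 * (3 * (q + 5) + 2 + c) + 2 * (q + 5) - 14 = 8 * q + 30 + 2 * c := by omega
  have e8 : 3 * (q + 5) + 2 + c - (q + 5) = 2 * q + 12 + c := by omega
  rw [e0] at hmd hT ⊢
  rw [e1, e2] at hgap
  rw [e4] at hgap
  rw [e5] at hT
  rw [e6, e7]
  rw [e8] at hmd
  nlinarith [hgap, hT, hmd]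

/-- The mixed read, `2 ≤ d ≤ a − 3`, `D − z` `a`-bipartite on `(k − 1, a, d + 2)`, one off-side neighbour at `≤ a`:
slack `2 (e − 2)(q + 3 − e)`, `d = a − 1 − e`. -/
theorem rowA2_mixed (a d k m' S' T : ℕ) (ha : 5 ≤ a) (hd2 : 2 ≤ d) (hda : d + 3 ≤ a) (hk : 3 * a + 2 ≤ k)
    (hmd : m' + d + (a + 2) = a * (k - a)) (hS' : S' + (d + 2) * (k - 1 - 1 - (d + 2)) ≤ m' * (k - 1))
    (hT : T + (k - a - 2) ≤ d * (k - a - 2) + a) :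
    S' + 2 * T + d + d * d + (a + 2) * (k - 1 - (a + 2)) + (2 * k + 2 * a - 14) ≤ (m' + d) * k := by
  obtain ⟨q, rfl⟩ : ∃ q, a = q + 5 := ⟨a - 5, by omega⟩
  obtain ⟨e, he⟩ : ∃ e, d + e = q + 4 := ⟨q + 4 - d, by omega⟩
  have he2 : 2 ≤ e := by omega
  have he3 : e ≤ q + 2 := by omega
  obtain ⟨c, rfl⟩ : ∃ c, k = 3 * (q + 5) + 2 + c := ⟨k - (3 * (q + 5) + 2), by omega⟩
  have e1 : 3 * (q + 5) + 2 + c - 1 - 1 - (d + 2) = 2 * q + 9 + c + e := by omega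
  have e4 : 3 * (q + 5) + 2 + c - 1 = 3 * q + 16 + c := by omega
  have e5 : 3 * (q + 5) + 2 + c - (q + 5) - 2 = 2 * q + 10 + c := by omega
  have e6 : 3 * (q + 5) + 2 + c - 1 - (q + 5 + 2) = 2 * q + 9 + c := by omega
  have e7 : 2 * (3 * (q + 5) + 2 + c) + 2 * (q + 5) - 14 = 8 * q + 30 + 2 * c := by omega
  have e8 : 3 * (q + 5) + 2 + c - (q + 5) = 2 * q + 12 + c := by omega
  rw [e1, e4] at hS'
  rw [e5] at hT
  rw [e6, e7]
  rw [e8] at hmd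
  obtain ⟨x, rfl⟩ : ∃ x, e = x + 2 := ⟨e - 2, by omega⟩
  have hx : x ≤ q := by omega
  have hxx : x * x ≤ x * q := Nat.mul_le_mul_left x hx
  nlinarith [hS', hT, hmd, hxx, he]

end C047

end TriangleCap

end PercRepro
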